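import Summits.Ventures.YMGap.RobustBall.StringTensionOnBall
import HarnessLib

/-!
# Robust ball (Y2), area-law side — the area law and the string tension UNIFORM IN THE COUPLING `0 ≤ β ≤ β⋆` (the «UpTo» form)

HONEST FRAMING: venture file of the cell `pub-ymgap` (QuantumFields programme), track ROBUST-BALL, seat rb-p2 (g2).  Strong-coupling LATTICE
statements; nothing about the continuum, a spectral mass gap, or Clay.

WHAT.  `AreaLawOnBall N d β ε₀ ε₁ r mv` gives constants `(C, c)` for ONE coupling `β`.  The affine-vertex door is monotone in `|β|` and its output
constants depend on the Dobrushin row sum only THROUGH AN UPPER BOUND for it, so the same door run with the row bound of the largest coupling `β⋆`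
yields ONE pair `(C, c)`, `c > 0`, serving EVERY coupling `0 ≤ β ≤ β⋆` at once — the area-law analogue of rb-theory's `TorusClusteringOnBallUpTo`:
* `slabCovariance_of_oneLinkKRModulus_vertex_le` — g0's site-dependent slab door with a PRESCRIBED row bound `c ≤ 1` (constants `8N/c'`,
  `−log c'/max(nr,1)`, `c' = max(c, 1/2)`);
* `areaLawOnBallUpTo_of_oneLinkKRModulus_vertex` — `∃ C c, 0 < c ∧ ∀ β ∈ [0, β⋆], ∀ L, ∀ W ∈ ClusterDomainFR ε₀ ε₁ r ∩ IsSlabLocal mv, ∀ loops,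
  |⟨W_{R×T}⟩_{β,W,L}| ≤ C^{2(R+T)} e^{−cRT}` under the affine-vertex conditions AT `β⋆`;
* `stringTension_onBallUpTo` — consequently ONE `(C, c)` such that every infinite-volume limit state of every eventually-member family AT ANY COUPLING
  `β ∈ [0, β⋆]` obeys `HasAreaLawWith μ χ_N C c` and has string tension `≥ c` whenever it exists;
* `SU(2)`, `d = 4` instances on the balls of record: `β⋆_W = 1/3`, radius `0.15` (`su2_areaLawOnBallUpTo_oneThird`, `su2_stringTension_onBallUpTo_oneThird`).
NOT CLAIMED: existence of the string tension for members; monotonicity of the loop expectations themselves in `β`.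
-/

noncomputable section

open MeasureTheory ProbabilityTheory Filter Topology
open Literature.Probability.LatticeModels hiding glue Site
open Literature.Probability.LatticeModels.DobrushinMetric
open Literature.MathematicalPhysics.QuantumLattice (fundamentalRep continuous_fundamentalRep fundamentalRep_apply normalisedCharacter
  LGConfig HasAreaLawWith HasStringTension)
open Literature.MathematicalPhysics.QuantumFieldTheory hiding ZdEdge
open Literature.MathematicalPhysics.QuantumFieldTheory.DurhuusFrohlich
open Literature.MathematicalPhysics.QuantumFieldTheory.Balaban1983to89.StrongCouplingDobrushinWindow (OneLinkKRModulus)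

namespace Summit.Ventures.YMGap.RobustBall

variable {n L N : ℕ}

/-! ### 1. The site-dependent slab door with a prescribed row bound -/

/-- **Slab covariance on the ball, affine-vertex form, PRESCRIBED ROW BOUND.**  As g0's `slabCovariance_of_oneLinkKRModulus_vertex`, but the
Dobrushin row sum `e^{ε₀}c_W + max(2√N e^{ε₀}c_W, √N)·ε₁` (`c_W = 2n|βt|K`) is only required to be `≤ c` for a prescribed `0 ≤ c ≤ 1`, and the
clustering constants are `(8N/c', (−log c')/max(nr,1))`, `c' = max(c, 1/2)` — independent of `βt`. [folklore] -/
theorem slabCovariance_of_oneLinkKRModulus_vertex_le [NeZero L] (hN : 1 ≤ N) (βt : ℝ) {R K : ℝ} (hK : 0 ≤ K)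
    (hmod : OneLinkKRModulus N R K) (hR : |βt| * (2 * (n : ℝ)) ≤ R) {ε₀ ε₁ c : ℝ} (r : ℕ) (hc0 : 0 ≤ c) (hc1 : c ≤ 1)
    (hle : Real.exp ε₀ * (2 * (n : ℝ) * |βt| * K) +
      max (2 * Real.sqrt N * (Real.exp ε₀ * (2 * (n : ℝ) * |βt| * K))) (Real.sqrt N) * ε₁ ≤ c)
    (W : Perturbation (n + 1) L N) (hWball : W ∈ ClusterDomainFR ε₀ ε₁ r)
    (v : Fin (n + 1)) (t : ZMod L) (rest : {e : Edge (n + 1) L // ¬ IsSlab v t e} → SU N) (x y : Site n L)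
    (i j k l : Fin N) (φ ψ : ℂ → ℝ) (hφ : φ = Complex.re ∨ φ = Complex.im) (hψ : ψ = Complex.re ∨ ψ = Complex.im) :
    |cov[fun Q => φ ((Q x : Matrix (Fin N) (Fin N) ℂ) i j),
        fun Q => ψ ((((Q y)⁻¹ : Matrix.specialUnitaryGroup (Fin N) ℂ) : Matrix (Fin N) (Fin N) ℂ) k l);
        slabLawW v t βt W.total rest]| ≤
      8 * N * (max c (1 / 2))⁻¹ * Real.exp (-(-Real.log (max c (1 / 2)) / (max (n * r) 1 : ℕ)) * torusGraphDist x y) := by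
  classical
  set cW : ℝ := 2 * (n : ℝ) * |βt| * K with hcW
  set M : ℝ := max (2 * Real.sqrt N * (Real.exp ε₀ * cW)) (Real.sqrt N) with hM
  obtain ⟨hrange, w, hosc, hlip⟩ := hWball
  have hcW0 : 0 ≤ cW := by positivity
  have hM0 : 0 ≤ M := le_max_of_le_right (Real.sqrt_nonneg _)
  have hsl0 : ∀ e, 0 ≤ w.selfLipLoad 0 e := fun e =>
    Finset.sum_nonneg fun X _ => mul_nonneg (Real.exp_pos _).le ((w.lip_spec X).nonneg e)
  have hcl0 : ∀ e, 0 ≤ w.crossLipLoad 0 e := fun e => Finset.sum_nonneg fun y _ => crossLip_nonneg w 0 e y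
  refine slabLawW_entry_cov_le_site (n := n) (L := L) (N := N) (W := W.total) hN v t (β := βt) (R := R) (K := K)
    (δ := ε₀) (c := c) hK (fun x' => w.selfLipLoad 0 (vlinkAt v t x'))
    (fun x' => w.crossLipLoad 0 (vlinkAt v t x')) (fun x' => hsl0 _) hR hmod W.measurable_total W.exists_abs_total_le rest
    (nbrBall r) (not_mem_nbrBall r) (fun x' η η' h => siteTiltW_total_dep W rest hrange x' η η' h)
    (fun x' ω g g' => (siteTiltW_total_osc W rest w x' ω g g').trans (hosc _))
    (fun x' ω g g' => siteTiltW_total_lip W rest w x' ω g g')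
    (crossCoeff W w v t) (fun x' y' => crossCoeff_nonneg W w x' y')
    (fun x' y' ω η h => siteTiltW_total_cross W rest w x' y' h)
    (fun x' => crossCoeff_rowsum_le W w r x') hc0 hc1 (fun x' => ?_) (le_max_right _ _)
    (fun z w' hw' => dist_le_of_mem_nbr r z w' hw') x y i j k l φ ψ hφ hψ
  -- the affine row at `x'` is below the vertex bound, which is below `c`
  set ℓ := w.selfLipLoad 0 (vlinkAt v t x') with hℓ
  set Λ := w.crossLipLoad 0 (vlinkAt v t x') with hΛ
  have hsum : ℓ + Λ ≤ ε₁ := hlip _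
  have h1 : 2 * Real.sqrt N * (Real.exp ε₀ * cW) * ℓ ≤ M * ℓ := mul_le_mul_of_nonneg_right (le_max_left _ _) (hsl0 _)
  have h2 : Real.sqrt N * Λ ≤ M * Λ := mul_le_mul_of_nonneg_right (le_max_right _ _) (hcl0 _)
  calc Real.exp ε₀ * (1 + 2 * Real.sqrt N * ℓ) * cW + Real.sqrt N * Λ
      = Real.exp ε₀ * cW + 2 * Real.sqrt N * (Real.exp ε₀ * cW) * ℓ + Real.sqrt N * Λ := by ring
    _ ≤ Real.exp ε₀ * cW + M * ℓ + M * Λ := by linarith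
    _ = Real.exp ε₀ * cW + M * (ℓ + Λ) := by ring
    _ ≤ Real.exp ε₀ * cW + M * ε₁ := by nlinarith
    _ ≤ c := hle

/-! ### 2. The area law uniform in `0 ≤ β ≤ β⋆` -/

/-- **AREA LAW ON THE BALL, UNIFORM IN THE COUPLING `0 ≤ β ≤ β⋆` (affine-vertex door).**  `N ≥ 2`, tree couplings, a one-link modulus
`OneLinkKRModulus N R K` on the slab ball `R ≥ 2n β⋆/N`, `0 ≤ ε₁`, and the affine-vertex conditions AT `β⋆`:
`e^{ε₀}(2n(β⋆/N)K)(1 + 2√N ε₁) < 1`, `e^{ε₀}(2n(β⋆/N)K) + √N ε₁ < 1`.  Then there is ONE pair `(C, c)`, `c > 0`, such that for EVERY `β ∈ [0, β⋆]`,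
every torus `L`, every `W ∈ ClusterDomainFR ε₀ ε₁ r` with `IsSlabLocal mv W`, and every `R′×T` loop with `2R′, 2T ≤ L`,
`|⟨W_{R′×T}⟩_{β,W,L}| ≤ C^{2(R′+T)} e^{−cR′T}`.  (The row sum at `β` is below the row sum at `β⋆`; the door's constants depend only on the latter.)
[cite: CaoNissimSheffield2025dynamical, Theorem 2.3] -/
theorem areaLawOnBallUpTo_of_oneLinkKRModulus_vertex (hN : 2 ≤ N) (βs : ℝ) (hβs : 0 ≤ βs) {R K : ℝ} (hK : 0 ≤ K)
    (hmod : OneLinkKRModulus N R K) (hR : βs / N * (2 * (n : ℝ)) ≤ R) {ε₀ ε₁ : ℝ} (h₁ : 0 ≤ ε₁) (r : ℕ) {mv : ℕ} (hmv : 1 ≤ mv)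
    (hv1 : Real.exp ε₀ * (2 * (n : ℝ) * (βs / N) * K) * (1 + 2 * Real.sqrt N * ε₁) < 1)
    (hv2 : Real.exp ε₀ * (2 * (n : ℝ) * (βs / N) * K) + Real.sqrt N * ε₁ < 1) :
    ∃ C c : ℝ, 0 < c ∧ ∀ β : ℝ, 0 ≤ β → β ≤ βs → ∀ (L : ℕ) [NeZero L] (W : Perturbation (n + 1) L N),
      W ∈ ClusterDomainFR ε₀ ε₁ r → IsSlabLocal mv W → ∀ (x : Site (n + 1) L) (i j : Fin (n + 1)) (R' T : ℕ), i ≠ j → 1 ≤ R' → 1 ≤ T →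
        2 * R' ≤ L → 2 * T ≤ L →
          |W.expectation (fundamentalRep (Fin N)) β (wilsonLoop (fundamentalRep (Fin N)) x i j R' T)| ≤
            C ^ (2 * (R' + T)) * Real.exp (-c * ((R' : ℝ) * T)) := by
  have hNpos : (0 : ℝ) < N := by exact_mod_cast (show 0 < N by omega)
  -- the row bound at `β⋆`
  set cWs : ℝ := 2 * (n : ℝ) * (βs / N) * K with hcWs
  set Ms : ℝ := max (2 * Real.sqrt N * (Real.exp ε₀ * cWs)) (Real.sqrt N) with hMs
  set cs : ℝ := Real.exp ε₀ * cWs + Ms * ε₁ with hcs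
  have hcWs0 : 0 ≤ cWs := by positivity
  have hcs1 : cs < 1 := by
    rcases le_total (2 * Real.sqrt N * (Real.exp ε₀ * cWs)) (Real.sqrt N) with h | h
    · rw [hcs, hMs, max_eq_right h]; exact hv2
    · rw [hcs, hMs, max_eq_left h]; nlinarith
  have hcs0 : 0 ≤ cs := by positivity
  -- constants
  set C₁ : ℝ := 8 * N * (max cs (1 / 2))⁻¹ with hC₁
  set C₂ : ℝ := -Real.log (max cs (1 / 2)) / (max (n * r) 1 : ℕ) with hC₂
  have hC₂pos : 0 < C₂ := doorRate_pos hcs1 (le_max_right (n * r) 1)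
  set A₀ : ℝ := max (N : ℝ) (Real.exp (C₂ / (2 * mv) *
    (2 * Real.log (max (((N : ℝ) ^ 2) ^ mv * (4 * C₁)) 1) / C₂) ^ 2)) with hA₀
  refine ⟨max A₀ 1, C₂ / (2 * mv), div_pos hC₂pos (by positivity), ?_⟩
  intro β hβ0 hβle L _ W hWball hWloc x i j R' T hij hR' hT hRL hTL
  -- the door at `β / N` with the row bound `cs`
  have hβN : |β / N| = β / N := abs_of_nonneg (div_nonneg hβ0 hNpos.le)
  have hβN' : β / N ≤ βs / N := div_le_div_of_nonneg_right hβle hNpos.le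
  have hRβ : |β / N| * (2 * (n : ℝ)) ≤ R := by
    rw [hβN]; exact le_trans (mul_le_mul_of_nonneg_right hβN' (by positivity)) hR
  have hcW_le : 2 * (n : ℝ) * |β / N| * K ≤ cWs := by
    rw [hβN, hcWs]; exact mul_le_mul_of_nonneg_right (mul_le_mul_of_nonneg_left hβN' (by positivity)) hK
  have hE0 : 0 < Real.exp ε₀ := Real.exp_pos _
  have hle : Real.exp ε₀ * (2 * (n : ℝ) * |β / N| * K) +
      max (2 * Real.sqrt N * (Real.exp ε₀ * (2 * (n : ℝ) * |β / N| * K))) (Real.sqrt N) * ε₁ ≤ cs := by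
    have hA : Real.exp ε₀ * (2 * (n : ℝ) * |β / N| * K) ≤ Real.exp ε₀ * cWs := mul_le_mul_of_nonneg_left hcW_le hE0.le
    have hB : max (2 * Real.sqrt N * (Real.exp ε₀ * (2 * (n : ℝ) * |β / N| * K))) (Real.sqrt N) ≤ Ms :=
      max_le_max (mul_le_mul_of_nonneg_left hA (by positivity)) le_rfl
    have hB' := mul_le_mul_of_nonneg_right hB h₁
    rw [hcs]; linarith
  have hNr : (N : ℝ) ≠ 0 := hNpos.ne'
  have hβ : (N : ℝ) * (β / N) = β := by field_simp
  have h := robust_slab_criterion_quasiLocal (n := n) (L := L) hN (β / N) W hmv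
    (fun v => hasVerticalRange_total_of_isSlabLocal hWloc v)
    (fun v t U => total_slabRotate_centre_of_isSlabLocal (by omega) hWloc v t U) hC₂pos
    (fun v t rest x' y' i' j' k' l' φ ψ hφ hψ =>
      slabCovariance_of_oneLinkKRModulus_vertex_le (by omega) (β / N) hK hmod hRβ r hcs0 hcs1.le hle W hWball v t rest
        x' y' i' j' k' l' φ ψ hφ hψ) x hij hRL hTL
  rw [hβ] at h
  exact areaLaw_shape_of_le (by omega) h

/-- The UpTo form contains the single-coupling currency at every `β ∈ [0, β⋆]`. [folklore] -/
theorem areaLawOnBall_of_upTo {d : ℕ} {βs ε₀ ε₁ : ℝ} {r mv : ℕ}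
    (h : ∃ C c : ℝ, 0 < c ∧ ∀ β : ℝ, 0 ≤ β → β ≤ βs → ∀ (L : ℕ) [NeZero L] (W : Perturbation d L N),
      W ∈ ClusterDomainFR ε₀ ε₁ r → IsSlabLocal mv W → ∀ (x : Site d L) (i j : Fin d) (R' T : ℕ), i ≠ j → 1 ≤ R' → 1 ≤ T →
        2 * R' ≤ L → 2 * T ≤ L →
          |W.expectation (fundamentalRep (Fin N)) β (wilsonLoop (fundamentalRep (Fin N)) x i j R' T)| ≤
            C ^ (2 * (R' + T)) * Real.exp (-c * ((R' : ℝ) * T)))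
    {β : ℝ} (hβ0 : 0 ≤ β) (hβ : β ≤ βs) : AreaLawOnBall N d β ε₀ ε₁ r mv := by
  obtain ⟨C, c, hc, hA⟩ := h
  exact ⟨C, c, hc, fun L _ W hW hloc x i j R' T hij hR hT hRL hTL => hA β hβ0 hβ L W hW hloc x i j R' T hij hR hT hRL hTL⟩

/-! ### 3. String tension uniform in the coupling -/

/-- **STRING TENSION ON THE BALL, UNIFORM IN THE COUPLING.**  From the UpTo torus area law (`d ≥ 2`): ONE pair `(C, c)`, `c > 0`, such that for
EVERY `β ∈ [0, β⋆]`, every family eventually in `ClusterDomainFR ε₀ ε₁ r ∩ IsSlabLocal mv` and every `μ ∈ perturbedLimitPoints β 𝓦`: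
`HasAreaLawWith μ χ_N C c` and `σ ≥ c` whenever `HasStringTension μ χ_N σ`. [folklore] -/
theorem stringTension_onBallUpTo {d : ℕ} [NeZero d] {βs ε₀ ε₁ : ℝ} {r mv : ℕ}
    (h : ∃ C c : ℝ, 0 < c ∧ ∀ β : ℝ, 0 ≤ β → β ≤ βs → ∀ (L : ℕ) [NeZero L] (W : Perturbation d L N),
      W ∈ ClusterDomainFR ε₀ ε₁ r → IsSlabLocal mv W → ∀ (x : Site d L) (i j : Fin d) (R' T : ℕ), i ≠ j → 1 ≤ R' → 1 ≤ T →
        2 * R' ≤ L → 2 * T ≤ L →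
          |W.expectation (fundamentalRep (Fin N)) β (wilsonLoop (fundamentalRep (Fin N)) x i j R' T)| ≤
            C ^ (2 * (R' + T)) * Real.exp (-c * ((R' : ℝ) * T)))
    (hd : 2 ≤ d) :
    ∃ C c : ℝ, 0 < c ∧ ∀ β : ℝ, 0 ≤ β → β ≤ βs → ∀ 𝓦 : PerturbationFamily d N,
      (∀ᶠ L : ℕ in atTop, 𝓦 L ∈ ClusterDomainFR ε₀ ε₁ r ∧ IsSlabLocal mv (𝓦 L)) →
        ∀ μ ∈ perturbedLimitPoints β 𝓦,
          HasAreaLawWith μ (fun g => normalisedCharacter N (fundamentalRep (Fin N) g)) C c ∧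
          (∀ σ : ℝ, HasStringTension μ (fun g => normalisedCharacter N (fundamentalRep (Fin N) g)) σ → c ≤ σ) := by
  obtain ⟨C, c, hc, hA⟩ := h
  refine ⟨C, c, hc, fun β hβ0 hβ 𝓦 h𝓦 μ hμ => ?_⟩
  have hW : HasAreaLawWith μ (fun g => normalisedCharacter N (fundamentalRep (Fin N) g)) C c :=
    hasAreaLawWith_of_torusBound (β := β) (fun L => {W | W ∈ ClusterDomainFR ε₀ ε₁ r ∧ IsSlabLocal mv W})
      (fun L W hW R' T hR hT hRL hTL => hA β hβ0 hβ (L + 1) W hW.1 hW.2 0 0 1 R' T (fin_zero_ne_one_of_two_le hd) hR hT hRL hTL)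
      𝓦 h𝓦 hμ
  exact ⟨hW, fun σ hσ => hW.le_of_hasStringTension hσ⟩

/-! ### 4. `SU(2)`, `d = 4` -/

/-- **`SU(2)`, `d = 4`: the area law UNIFORM ON `0 ≤ β_W ≤ 1/3`, ball `(3/10, 3/20)`** (quarter modulus, affine vertex; the certificate of
`su2_areaLawOnBall_oneThird_vertex` at the top coupling): one `(C, c)`, `c > 0`, for every tree coupling `β ∈ [0, 1/6]`, every torus, every member,
every loop. [folklore] -/
theorem su2_areaLawOnBallUpTo_oneThird (r : ℕ) {mv : ℕ} (hmv : 1 ≤ mv) :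
    ∃ C c : ℝ, 0 < c ∧ ∀ β : ℝ, 0 ≤ β → β ≤ 1 / 6 → ∀ (L : ℕ) [NeZero L] (W : Perturbation 4 L 2),
      W ∈ ClusterDomainFR (3 / 10) (3 / 20) r → IsSlabLocal mv W → ∀ (x : Site 4 L) (i j : Fin 4) (R' T : ℕ), i ≠ j → 1 ≤ R' → 1 ≤ T →
        2 * R' ≤ L → 2 * T ≤ L →
          |W.expectation (fundamentalRep (Fin 2)) β (wilsonLoop (fundamentalRep (Fin 2)) x i j R' T)| ≤
            C ^ (2 * (R' + T)) * Real.exp (-c * ((R' : ℝ) * T)) := by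
  have hmod := SlabAreaLawDimensions.su2_oneLinkKRModulus_of_le_one (R := 1 / 2) (by norm_num)
  have he := exp_three_tenths_le
  have hs := sqrt_two_le_1415
  have he0 : 0 < Real.exp (3 / 10 : ℝ) := Real.exp_pos _
  have hs0 : 0 ≤ Real.sqrt 2 := Real.sqrt_nonneg _
  have hcW : 2 * ((3 : ℕ) : ℝ) * ((1 / 6 : ℝ) / (2 : ℕ)) * 1 = 1 / 2 := by push_cast; norm_num
  obtain ⟨C, c, hc, hA⟩ := areaLawOnBallUpTo_of_oneLinkKRModulus_vertex (n := 3) (N := 2) le_rfl (1 / 6) (by norm_num) zero_le_one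
    hmod (by push_cast; norm_num) (ε₀ := 3 / 10) (ε₁ := 3 / 20) (by norm_num) r hmv
    (by rw [hcW]; nlinarith [mul_nonneg he0.le hs0]) (by rw [hcW]; nlinarith)
  exact ⟨C, c, hc, hA⟩

/-- **`SU(2)`, `d = 4`: STRING TENSION ON THE BALL `(3/10, 3/20)` UNIFORM ON `0 ≤ β_W ≤ 1/3`.**  One `(C, c)`, `c > 0`: for every tree coupling
`β ∈ [0, 1/6]`, every family eventually in the ball (range `r`, window `mv`) and every infinite-volume limit state `μ`, `HasAreaLawWith μ χ₂ C c` and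
`σ ≥ c` whenever the string tension `σ` of `μ` exists. [folklore] -/
theorem su2_stringTension_onBallUpTo_oneThird (r : ℕ) {mv : ℕ} (hmv : 1 ≤ mv) :
    ∃ C c : ℝ, 0 < c ∧ ∀ β : ℝ, 0 ≤ β → β ≤ 1 / 6 → ∀ 𝓦 : PerturbationFamily 4 2,
      (∀ᶠ L : ℕ in atTop, 𝓦 L ∈ ClusterDomainFR (3 / 10) (3 / 20) r ∧ IsSlabLocal mv (𝓦 L)) →
        ∀ μ ∈ perturbedLimitPoints β 𝓦,
          HasAreaLawWith μ (fun g => normalisedCharacter 2 (fundamentalRep (Fin 2) g)) C c ∧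
          (∀ σ : ℝ, HasStringTension μ (fun g => normalisedCharacter 2 (fundamentalRep (Fin 2) g)) σ → c ≤ σ) :=
  stringTension_onBallUpTo (su2_areaLawOnBallUpTo_oneThird r hmv) (by norm_num)

end Summit.Ventures.YMGap.RobustBall

end
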